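import Literature.MathematicalPhysics.QuantumFieldTheory.FiniteTemperatureTemporalGauge
import Literature.MathematicalPhysics.QuantumFieldTheory.SU2TwoLinkConvolution
import Mathlib.Analysis.Real.Pi.Bounds
import Mathlib.Analysis.Complex.ExponentialBounds
import HarnessLib

/-!
# The `SU(2)` transfer kernel of the finite-temperature theory: the ring recursion
# `K_{L₀}(Ω, Ω') ≤ C_{L₀}(J) · J(Ω, Ω'; b_{L₀}(J))` (Tomboulis–Yaffe (3.13)–(3.15)) and the cap lower bound

For `G = SU(2)` in the fundamental representation the transfer kernel of `FiniteTemperatureTemporalGauge.lean`,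
`K_{L₀}(g, g') = transferKernel ρ₂ L₀ J g g' = ∫ ∏_t e^{J Re tr(ring plaquette_t)} ∏_t dW_t`, a ring of `L₀` one-link
Boltzmann factors `h_{2J}(Q) = e^{2J ½Re tr Q}` closed through the two twists, is bounded above by merging the ring
factors one at a time with the two-link MERGE BOUND of `SU2TwoLinkConvolution.lean`
(`∫ dV h_a(PV⁻¹) h_b(V) ≤ Φ(a+b) e^{−b'(1 − ½Re tr P)}`, `b' = ab ln Φ(a+b)/(a+b)²`): after `L₀ − 1` merges and the
last free integration one obtains Tomboulis–Yaffe's (3.15),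

`K_{L₀}(g, g') ≤ C_{L₀−1}(J) · pairKernel (b_{L₀−1}(J)) g g'`            (`transferKernel_le_pairKernel`)

with the explicit recursions `b₀ = 2J`, `b_{j+1} = 2J b_j ln Φ(2J + b_j)/(2J + b_j)²` ("the image of `β_t` under the
`k`-th iterate of the mapping (3.14)") and `C₀ = 1`, `C_{j+1} = C_j Φ(2J + b_j) e^{−b_{j+1}}` (TY's `e^{F_>}`).
[cite: TomboulisYaffe1985, §III (3.13)–(3.15), p. 324; App. III, pp. 337–338]

Conversely (`le_transferKernel_of_classAngle_le`), restricting the `L₀ − 1` relative ring variables `W_t W_0⁻¹` to the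
polar cap `{θ ≤ δ}` bounds `K_{L₀}` BELOW on pairs of twists in the cap `{θ ≤ ε}`:
`K_{L₀}(g,g') ≥ μ(cap_δ)^{L₀−1} · exp{2J[(L₀−1) cos 2δ + cos(2ε + δ)]}` — this replaces TY's lower bound on the full
partition function (App. III.B) at the precision needed for the disorder bounds (no rate).  With `δ = ε = J^{−1/2}`
and the cubic small-ball law this gives the TWO-SIDED bound at coincidence `K_{L₀} ≥ κ_{L₀−1} · C_{L₀−1} e^{b_{L₀−1}}`
(`kernelScale_le_transferKernel`; both sides `≍ e^{2JL₀} J^{−3(L₀−1)/2}`), and `2J/4^j ≤ b_j ≤ 2J` (`bSeq_ge`,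
`bSeq_le`, `J ≥ 16`).
-/

open MeasureTheory Filter Function
open scoped ENNReal
open Literature.MathematicalPhysics.QuantumLattice (fundamentalRep fundamentalRep_apply continuous_fundamentalRep)
open Literature.MathematicalPhysics.QuantumFieldTheory.SU2PairKernel
open Literature.Computability.QuantumComplexity (torus exists_conj_torus)

namespace Literature.MathematicalPhysics.QuantumFieldTheory.TomboulisYaffeHighTemperature

noncomputable section

/-! ### §1. Positions on the ring `ℤ_{n+1}` -/

section Positions

variable {n : ℕ}

/-- The position `j mod (n+1)` on the ring. [folklore] -/
def pos (n j : ℕ) : ZMod (n + 1) := (j : ZMod (n + 1))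

/-- `(pos j).val = j` for `j ≤ n`. [folklore] -/
private theorem pos_val {j : ℕ} (hj : j ≤ n) : (pos n j).val = j := by
  rw [pos, ZMod.val_natCast, Nat.mod_eq_of_lt (by omega)]

/-- `pos j + 1 = pos (j+1)`. [folklore] -/
private theorem pos_add_one (j : ℕ) : pos n j + 1 = pos n (j + 1) := by
  simp [pos]

/-- `pos n + 1 = 0` (the ring closes). [folklore] -/
private theorem pos_last_add_one : pos n n + 1 = 0 := by
  rw [pos_add_one, pos]; exact_mod_cast ZMod.natCast_self (n + 1)

/-- `pos 0 = 0`. [folklore] -/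
private theorem pos_zero : pos n 0 = 0 := by simp [pos]

/-- Every ring position is `pos` of its value. [folklore] -/
private theorem eq_pos_val (t : ZMod (n + 1)) : t = pos n t.val := (ZMod.natCast_zmod_val t).symm

/-- `pos (j+1) ≠ 0` for `j + 1 ≤ n`. [folklore] -/
private theorem pos_succ_ne_zero {j : ℕ} (hj : j + 1 ≤ n) : pos n (j + 1) ≠ 0 := by
  intro h
  have := pos_val hj
  rw [h, ZMod.val_zero] at this
  omega

/-- The merged positions `{1, …, j}`. [folklore] -/
def mergedPos (n j : ℕ) : Finset (ZMod (n + 1)) := Finset.univ.filter fun t => 1 ≤ t.val ∧ t.val ≤ j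

/-- The remaining positions `{t : j < t.val}`. [folklore] -/
def restPos (n j : ℕ) : Finset (ZMod (n + 1)) := Finset.univ.filter fun t => j < t.val

/-- Membership in `mergedPos`. [folklore] -/
@[simp] private theorem mem_mergedPos {j : ℕ} (t : ZMod (n + 1)) : t ∈ mergedPos n j ↔ 1 ≤ t.val ∧ t.val ≤ j := by
  simp [mergedPos]

/-- Membership in `restPos`. [folklore] -/
@[simp] private theorem mem_restPos {j : ℕ} (t : ZMod (n + 1)) : t ∈ restPos n j ↔ j < t.val := by
  simp [restPos]

/-- `mergedPos (j+1) = {pos (j+1)} ∪ mergedPos j` (`j + 1 ≤ n`). [folklore] -/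
private theorem mergedPos_succ {j : ℕ} (hj : j + 1 ≤ n) :
    mergedPos n (j + 1) = {pos n (j + 1)} ∪ mergedPos n j := by
  ext t
  simp only [mem_mergedPos, Finset.mem_union, Finset.mem_singleton]
  constructor
  · rintro ⟨h1, h2⟩
    by_cases h : t.val = j + 1
    · left; rw [eq_pos_val t, h]
    · right; exact ⟨h1, by omega⟩
  · rintro (h | ⟨h1, h2⟩)
    · rw [h, pos_val hj]; omega
    · exact ⟨h1, by omega⟩

/-- `pos (j+1) ∉ mergedPos j`. [folklore] -/
private theorem pos_succ_notMem_mergedPos {j : ℕ} (hj : j + 1 ≤ n) : pos n (j + 1) ∉ mergedPos n j := by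
  rw [mem_mergedPos, pos_val hj]; omega

/-- `mergedPos 0 = ∅`. [folklore] -/
private theorem mergedPos_zero : mergedPos n 0 = ∅ := by
  ext t; simp only [mem_mergedPos, Finset.notMem_empty, iff_false]; omega

/-- `{0} ∪ mergedPos n = univ`. [folklore] -/
private theorem zero_union_mergedPos : ({0} : Finset (ZMod (n + 1))) ∪ mergedPos n n = Finset.univ := by
  ext t
  simp only [Finset.mem_union, Finset.mem_singleton, mem_mergedPos, Finset.mem_univ, iff_true]
  by_cases h : t.val = 0
  · left; rw [eq_pos_val t, h, pos_zero]
  · right; exact ⟨by omega, by have := ZMod.val_lt t; omega⟩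

/-- `0 ∉ mergedPos n`. [folklore] -/
private theorem zero_notMem_mergedPos (j : ℕ) : (0 : ZMod (n + 1)) ∉ mergedPos n j := by
  rw [mem_mergedPos, ZMod.val_zero]; omega

/-- `restPos j = insert (pos (j+1)) (restPos (j+1))` (`j + 1 ≤ n`). [folklore] -/
private theorem restPos_eq_insert {j : ℕ} (hj : j + 1 ≤ n) :
    restPos n j = insert (pos n (j + 1)) (restPos n (j + 1)) := by
  ext t
  simp only [mem_restPos, Finset.mem_insert]
  constructor
  · intro h
    by_cases h' : t.val = j + 1
    · left; rw [eq_pos_val t, h']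
    · right; omega
  · rintro (h | h)
    · rw [h, pos_val hj]; omega
    · omega

/-- `pos (j+1) ∉ restPos (j+1)`. [folklore] -/
private theorem pos_succ_notMem_restPos {j : ℕ} (hj : j + 1 ≤ n) : pos n (j + 1) ∉ restPos n (j + 1) := by
  rw [mem_restPos, pos_val hj]; omega

/-- `restPos n = ∅`. [folklore] -/
private theorem restPos_last : restPos n n = ∅ := by
  ext t; simp only [mem_restPos, Finset.notMem_empty, iff_false]; have := ZMod.val_lt t; omega

/-- `univ = insert 0 (restPos 0)`. [folklore] -/
private theorem univ_eq_insert_zero_restPos : (Finset.univ : Finset (ZMod (n + 1))) = insert 0 (restPos n 0) := by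
  ext t
  simp only [Finset.mem_univ, Finset.mem_insert, mem_restPos, true_iff]
  by_cases h : t.val = 0
  · left; rw [eq_pos_val t, h, pos_zero]
  · right; omega

/-- `0 ∉ restPos 0`. [folklore] -/
private theorem zero_notMem_restPos : (0 : ZMod (n + 1)) ∉ restPos n 0 := by
  rw [mem_restPos, ZMod.val_zero]; omega

end Positions

/-! ### §2. The ring factors for `SU(2)` and the recursion data -/

section Ring

variable {n : ℕ}

/-- The "head" of the ring plaquette at position `t`: `W_{t+1}` before the wrap-around and `g W_0 g'⁻¹` at it, so that
the ring plaquette is `head_t · W_t⁻¹`. [cite: TomboulisYaffe1985, §III (3.12), p. 323] -/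
def ringHead (g g' : (Matrix.specialUnitaryGroup (Fin 2) ℂ)) (W : ZMod (n + 1) → (Matrix.specialUnitaryGroup (Fin 2) ℂ))
    (t : ZMod (n + 1)) : (Matrix.specialUnitaryGroup (Fin 2) ℂ) :=
  (if t + 1 = 0 then g else 1) * W (t + 1) * (if t + 1 = 0 then g' else 1)⁻¹

/-- `twistPlaq g g' W t = ringHead g g' W t · (W t)⁻¹`. [cite: TomboulisYaffe1985, §III (3.12), p. 323] -/
theorem twistPlaq_eq_ringHead_mul (g g' : (Matrix.specialUnitaryGroup (Fin 2) ℂ))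
    (W : ZMod (n + 1) → (Matrix.specialUnitaryGroup (Fin 2) ℂ)) (t : ZMod (n + 1)) :
    twistPlaq g g' W t = ringHead g g' W t * (W t)⁻¹ := rfl

/-- The one-plaquette factor in the fundamental representation of `SU(2)`: `e^{J Re tr Q} = e^{2J ½Re tr Q}`.
[cite: TomboulisYaffe1985, §III (3.12), p. 323] -/
theorem plaqFactor_fundamentalRep (J : ℝ) (Q : (Matrix.specialUnitaryGroup (Fin 2) ℂ)) :
    plaqFactor (fundamentalRep (Fin 2)) J Q = ENNReal.ofReal (Real.exp (2 * J * htr Q)) := by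
  rw [plaqFactor, fundamentalRep_apply, htr]
  congr 2
  ring

/-- The ring factor at position `t`. [cite: TomboulisYaffe1985, §III (3.12), p. 323] -/
def ringFac (J : ℝ) (g g' : (Matrix.specialUnitaryGroup (Fin 2) ℂ)) (W : ZMod (n + 1) → (Matrix.specialUnitaryGroup (Fin 2) ℂ))
    (t : ZMod (n + 1)) : ℝ≥0∞ :=
  ENNReal.ofReal (Real.exp (2 * J * htr (ringHead g g' W t * (W t)⁻¹)))

/-- The transfer-kernel integrand is the product of the ring factors. [cite: TomboulisYaffe1985, §III (3.12), p. 323] -/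
theorem prod_plaqFactor_eq_prod_ringFac (J : ℝ) (g g' : (Matrix.specialUnitaryGroup (Fin 2) ℂ))
    (W : ZMod (n + 1) → (Matrix.specialUnitaryGroup (Fin 2) ℂ)) :
    ∏ t, plaqFactor (fundamentalRep (Fin 2)) J (twistPlaq g g' W t) = ∏ t, ringFac J g g' W t := by
  refine Finset.prod_congr rfl fun t _ => ?_
  rw [plaqFactor_fundamentalRep, twistPlaq_eq_ringHead_mul, ringFac]

/-- **The renormalised couplings** `b₀ = 2J`, `b_{j+1} = 2J b_j ln Φ(2J + b_j)/(2J + b_j)²` (TY's iterates of (3.14)).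
[cite: TomboulisYaffe1985, §III (3.14), p. 324] -/
def bSeq (J : ℝ) : ℕ → ℝ
  | 0 => 2 * J
  | j + 1 => 2 * J * bSeq J j * Real.log (classExp (2 * J + bSeq J j)) / (2 * J + bSeq J j) ^ 2

/-- **The prefactors** `C₀ = 1`, `C_{j+1} = C_j Φ(2J + b_j) e^{−b_{j+1}}` (TY's `e^{F_>}`, (3.15)/(A3.5)).
[cite: TomboulisYaffe1985, §III (3.15), p. 324] -/
def cSeq (J : ℝ) : ℕ → ℝ
  | 0 => 1
  | j + 1 => cSeq J j * classExp (2 * J + bSeq J j) * Real.exp (-bSeq J (j + 1))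

/-- `b_j ≥ 0` for `J ≥ 0`. [cite: TomboulisYaffe1985, §III (3.14), p. 324] -/
theorem bSeq_nonneg {J : ℝ} (hJ : 0 ≤ J) : ∀ j, 0 ≤ bSeq J j
  | 0 => by simp only [bSeq]; linarith
  | j + 1 => by
      simp only [bSeq]
      exact div_nonneg (mul_nonneg (mul_nonneg (by linarith) (bSeq_nonneg hJ j))
        (Real.log_nonneg (one_le_classExp _))) (sq_nonneg _)

/-- `C_j > 0`. [cite: TomboulisYaffe1985, §III (3.15), p. 324] -/
theorem cSeq_pos (J : ℝ) : ∀ j, 0 < cSeq J j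
  | 0 => by simp [cSeq]
  | j + 1 => by
      simp only [cSeq]
      exact mul_pos (mul_pos (cSeq_pos J j) (classExp_pos _)) (Real.exp_pos _)

/-- The inductive bound after merging the positions `1, …, j`: the product of the remaining ring factors, times the
merged Gaussian factor between `W_0` and the head at position `j`. [cite: TomboulisYaffe1985, §III (3.13)–(3.15), p. 324] -/
def mergeBound (J : ℝ) (g g' : (Matrix.specialUnitaryGroup (Fin 2) ℂ)) (j : ℕ)
    (W : ZMod (n + 1) → (Matrix.specialUnitaryGroup (Fin 2) ℂ)) : ℝ≥0∞ :=
  ENNReal.ofReal (cSeq J j) * (∏ t ∈ restPos n j, ringFac J g g' W t) *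
    ENNReal.ofReal (Real.exp (bSeq J j * htr (ringHead g g' W (pos n j) * (W 0)⁻¹)))

variable (J : ℝ) (g g' : (Matrix.specialUnitaryGroup (Fin 2) ℂ))

/-- The ring factors are continuous in the ring variables. [folklore] -/
private theorem continuous_ringHead (t : ZMod (n + 1)) :
    Continuous fun W : ZMod (n + 1) → (Matrix.specialUnitaryGroup (Fin 2) ℂ) => ringHead g g' W t := by
  unfold ringHead
  exact (continuous_const.mul (continuous_apply _)).mul continuous_const

/-- The ring factors are measurable in the ring variables. [folklore] -/
private theorem measurable_ringFac (t : ZMod (n + 1)) :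
    Measurable fun W : ZMod (n + 1) → (Matrix.specialUnitaryGroup (Fin 2) ℂ) => ringFac J g g' W t := by
  unfold ringFac
  refine ENNReal.measurable_ofReal.comp (Real.continuous_exp.comp (continuous_const.mul
    ((Complex.continuous_re.comp (continuous_subtype_val.matrix_trace)).div_const _ |>.comp
      ((continuous_ringHead g g' t).mul (continuous_apply t).inv)))).measurable

/-- The ring integrand is measurable. [folklore] -/
private theorem measurable_prod_ringFac :
    Measurable fun W : ZMod (n + 1) → (Matrix.specialUnitaryGroup (Fin 2) ℂ) => ∏ t, ringFac J g g' W t :=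
  Finset.measurable_prod _ fun t _ => measurable_ringFac J g g' t

/-- Base case: before any merge the integrand equals the bound with `C₀ = 1`, `b₀ = 2J`. [folklore] -/
private theorem prod_ringFac_eq_mergeBound_zero (W : ZMod (n + 1) → (Matrix.specialUnitaryGroup (Fin 2) ℂ)) :
    ∏ t, ringFac J g g' W t = mergeBound J g g' 0 W := by
  rw [mergeBound, univ_eq_insert_zero_restPos, Finset.prod_insert zero_notMem_restPos, cSeq, bSeq,
    ENNReal.ofReal_one, one_mul, mul_comm, pos_zero, ringFac]

end Ring

/-! ### §3. The merge recursion and the upper bound `K_{L₀} ≤ C_{L₀−1} · J(·,·; b_{L₀−1})` -/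

section Recursion

variable {n : ℕ} (J : ℝ) (g g' : (Matrix.specialUnitaryGroup (Fin 2) ℂ))

/-- Before the wrap-around the head at `pos j` is the next ring variable. [folklore] -/
private theorem ringHead_pos_of_succ_le {j : ℕ} (hj : j + 1 ≤ n)
    (W : ZMod (n + 1) → (Matrix.specialUnitaryGroup (Fin 2) ℂ)) :
    ringHead g g' W (pos n j) = W (pos n (j + 1)) := by
  rw [ringHead, pos_add_one, if_neg (pos_succ_ne_zero hj), if_neg (pos_succ_ne_zero hj), inv_one, one_mul, mul_one]

/-- At the wrap-around the head is the twisted `g W_0 g'⁻¹`. [folklore] -/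
private theorem ringHead_pos_last (W : ZMod (n + 1) → (Matrix.specialUnitaryGroup (Fin 2) ℂ)) :
    ringHead g g' W (pos n n) = g * W 0 * g'⁻¹ := by
  rw [ringHead, pos_last_add_one, if_pos rfl, if_pos rfl]

/-- Updating a ring variable not read by the head does not change it. [folklore] -/
private theorem ringHead_update_of_ne {p t : ZMod (n + 1)} (h : t + 1 ≠ p)
    (W : ZMod (n + 1) → (Matrix.specialUnitaryGroup (Fin 2) ℂ)) (V : (Matrix.specialUnitaryGroup (Fin 2) ℂ)) :
    ringHead g g' (update W p V) t = ringHead g g' W t := by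
  simp only [ringHead, update_of_ne h]

/-- Updating a ring variable not read by a ring factor does not change it. [folklore] -/
private theorem ringFac_update_of_ne {p t : ZMod (n + 1)} (h1 : t ≠ p) (h2 : t + 1 ≠ p)
    (W : ZMod (n + 1) → (Matrix.specialUnitaryGroup (Fin 2) ℂ)) (V : (Matrix.specialUnitaryGroup (Fin 2) ℂ)) :
    ringFac J g g' (update W p V) t = ringFac J g g' W t := by
  simp only [ringFac, ringHead_update_of_ne g g' h2, update_of_ne h1]

/-- The pair kernel in the `½Re tr` notation. [cite: TomboulisYaffe1985, §III (3.16)–(3.17), p. 324] -/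
theorem pairKernel_eq_integral_exp_htr (b : ℝ) :
    pairKernel b g g' = ∫ U, Real.exp (b * htr (g * U * g'⁻¹ * U⁻¹))
      ∂(QuantumFieldTheory.haarProbability (Matrix.specialUnitaryGroup (Fin 2) ℂ)) := by
  unfold pairKernel htr
  congr 1

/-- The one-variable integral of the merge step, after the substitution `V ↦ V W_0`:
`∫ dV e^{2J ½Re tr(H V⁻¹)} e^{b ½Re tr(V W₀⁻¹)} = ∫ dU e^{2J ½Re tr(H W₀⁻¹ U⁻¹)} e^{b ½Re tr U}`, bounded by the merge
bound at `P = H W₀⁻¹`. [cite: TomboulisYaffe1985, §III (3.13)–(3.14), p. 324] -/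
theorem lintegral_ringStep_le (hJ : 0 ≤ J) {b : ℝ} (hb : 0 ≤ b) (hJb : 0 < 2 * J + b)
    (H W₀ : (Matrix.specialUnitaryGroup (Fin 2) ℂ)) :
    ∫⁻ V, ENNReal.ofReal (Real.exp (2 * J * htr (H * V⁻¹))) * ENNReal.ofReal (Real.exp (b * htr (V * W₀⁻¹)))
        ∂(QuantumFieldTheory.haarProbability (Matrix.specialUnitaryGroup (Fin 2) ℂ)) ≤
      ENNReal.ofReal (classExp (2 * J + b) * Real.exp (-(2 * J * b * Real.log (classExp (2 * J + b)) / (2 * J + b) ^ 2))) *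
        ENNReal.ofReal (Real.exp ((2 * J * b * Real.log (classExp (2 * J + b)) / (2 * J + b) ^ 2) * htr (H * W₀⁻¹))) := by
  set f : (Matrix.specialUnitaryGroup (Fin 2) ℂ) → ℝ :=
    fun U => Real.exp (2 * J * htr (H * W₀⁻¹ * U⁻¹)) * Real.exp (b * htr U) with hf
  have hfc : Continuous f := by
    have hc : Continuous (htr : (Matrix.specialUnitaryGroup (Fin 2) ℂ) → ℝ) :=
      (Complex.continuous_re.comp (continuous_subtype_val.matrix_trace)).div_const _
    exact (Real.continuous_exp.comp (continuous_const.mul (hc.comp (continuous_const.mul continuous_inv)))).mul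
      (Real.continuous_exp.comp (continuous_const.mul hc))
  have hf0 : ∀ U, 0 ≤ f U := fun U => mul_nonneg (Real.exp_pos _).le (Real.exp_pos _).le
  have h1 : ∀ V : (Matrix.specialUnitaryGroup (Fin 2) ℂ),
      ENNReal.ofReal (Real.exp (2 * J * htr (H * V⁻¹))) * ENNReal.ofReal (Real.exp (b * htr (V * W₀⁻¹))) =
        ENNReal.ofReal (f (V * W₀⁻¹)) := by
    intro V
    rw [← ENNReal.ofReal_mul (Real.exp_pos _).le, hf]
    simp only [mul_inv_rev, inv_inv, mul_assoc, inv_mul_cancel_left]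
  simp_rw [h1]
  rw [lintegral_mul_right_eq_self (fun U => ENNReal.ofReal (f U)) W₀⁻¹,
    ← ofReal_integral_eq_lintegral_ofReal (hfc.integrable_of_hasCompactSupport (HasCompactSupport.of_compactSpace _))
      (Eventually.of_forall hf0),
    ← ENNReal.ofReal_mul (mul_nonneg (classExp_pos _).le (Real.exp_pos _).le)]
  refine ENNReal.ofReal_le_ofReal ?_
  have hm := integral_exp_htr_conv_le (a := 2 * J) (b := b) (by linarith) hb hJb (H * W₀⁻¹)
  refine hm.trans (le_of_eq ?_)
  have key : ∀ x y z : ℝ, x * Real.exp y * Real.exp z = x * Real.exp (y + z) := fun x y z => by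
    rw [mul_assoc, Real.exp_add]
  rw [key]
  congr 2
  ring

/-- **THE MERGE STEP**: integrating the ring variable at position `j + 1` turns the bound after `j` merges into the
bound after `j + 1` merges. [cite: TomboulisYaffe1985, §III (3.13)–(3.15), p. 324] -/
theorem lmarginal_singleton_mergeBound_le (hJ : 0 < J) {j : ℕ} (hj : j + 1 ≤ n)
    (W : ZMod (n + 1) → (Matrix.specialUnitaryGroup (Fin 2) ℂ)) :
    (∫⋯∫⁻_{pos n (j + 1)}, mergeBound J g g' j
        ∂fun _ : ZMod (n + 1) => QuantumFieldTheory.haarProbability (Matrix.specialUnitaryGroup (Fin 2) ℂ)) W ≤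
      mergeBound J g g' (j + 1) W := by
  classical
  set p : ZMod (n + 1) := pos n (j + 1) with hp
  have hp0 : p ≠ 0 := pos_succ_ne_zero hj
  have hpp : p + 1 ≠ p := by
    intro h
    have h1 : (1 : ZMod (n + 1)) = 0 := by simpa using h
    have h2 : ((1 : ZMod (n + 1))).val = 0 := by rw [h1, ZMod.val_zero]
    rw [ZMod.val_one_eq_one_mod, Nat.mod_eq_of_lt (by omega)] at h2
    exact one_ne_zero h2
  rw [lmarginal_singleton]
  -- the integrand after the update
  have hint : ∀ V : (Matrix.specialUnitaryGroup (Fin 2) ℂ), mergeBound J g g' j (update W p V) =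
      (ENNReal.ofReal (cSeq J j) * ∏ t ∈ restPos n (j + 1), ringFac J g g' W t) *
        (ENNReal.ofReal (Real.exp (2 * J * htr (ringHead g g' W p * V⁻¹))) *
          ENNReal.ofReal (Real.exp (bSeq J j * htr (V * (W 0)⁻¹)))) := by
    intro V
    rw [mergeBound, restPos_eq_insert hj, Finset.prod_insert (pos_succ_notMem_restPos hj), ← hp]
    have hA : ringHead g g' (update W p V) (pos n j) = V := by
      rw [ringHead_pos_of_succ_le g g' hj, ← hp, update_self]
    have h0 : update W p V 0 = W 0 := update_of_ne hp0.symm _ _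
    have hFp : ringFac J g g' (update W p V) p = ENNReal.ofReal (Real.exp (2 * J * htr (ringHead g g' W p * V⁻¹))) := by
      rw [ringFac, ringHead_update_of_ne g g' hpp, update_self]
    have hrest : ∏ t ∈ restPos n (j + 1), ringFac J g g' (update W p V) t =
        ∏ t ∈ restPos n (j + 1), ringFac J g g' W t := by
      refine Finset.prod_congr rfl fun t ht => ?_
      rw [mem_restPos] at ht
      refine ringFac_update_of_ne J g g' (fun h => ?_) (fun h => ?_) W V
      · rw [h, hp, pos_val hj] at ht; omega
      · have hv : (t + 1).val = j + 1 := by rw [h, hp, pos_val hj]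
        by_cases ht1 : t + 1 = 0
        · rw [ht1, ZMod.val_zero] at hv; omega
        · have hlt : t.val + 1 < n + 1 := by
            by_contra hc
            have htv : t.val = n := by have := ZMod.val_lt t; omega
            exact ht1 (by rw [eq_pos_val t, htv, pos_last_add_one])
          have h1v : (1 : ZMod (n + 1)).val = 1 := by
            rw [ZMod.val_one_eq_one_mod, Nat.mod_eq_of_lt (by omega)]
          have hval : (t + 1).val = t.val + 1 := by
            rw [ZMod.val_add_of_lt (by rw [h1v]; exact hlt), h1v]
          rw [hval] at hv
          omega
    rw [hA, h0, hFp, hrest]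
    ring
  simp_rw [hint]
  have hmeas : Measurable fun V : (Matrix.specialUnitaryGroup (Fin 2) ℂ) =>
      ENNReal.ofReal (Real.exp (2 * J * htr (ringHead g g' W p * V⁻¹))) *
        ENNReal.ofReal (Real.exp (bSeq J j * htr (V * (W 0)⁻¹))) := by
    have hc : Continuous (htr : (Matrix.specialUnitaryGroup (Fin 2) ℂ) → ℝ) :=
      (Complex.continuous_re.comp (continuous_subtype_val.matrix_trace)).div_const _
    exact ((ENNReal.measurable_ofReal.comp (Real.continuous_exp.comp (continuous_const.mul
      (hc.comp (continuous_const.mul continuous_inv)))).measurable)).mul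
      ((ENNReal.measurable_ofReal.comp (Real.continuous_exp.comp (continuous_const.mul
      (hc.comp (continuous_id.mul continuous_const)))).measurable))
  rw [lintegral_const_mul _ hmeas]
  have hb := bSeq_nonneg hJ.le j
  have hJb : 0 < 2 * J + bSeq J j := by linarith
  have hstep := lintegral_ringStep_le J hJ.le hb hJb (ringHead g g' W p) (W 0)
  refine (mul_le_mul_right hstep _).trans (le_of_eq ?_)
  rw [mergeBound, ← hp]
  have hC : ENNReal.ofReal (cSeq J (j + 1)) = ENNReal.ofReal (cSeq J j) *
      ENNReal.ofReal (classExp (2 * J + bSeq J j) * Real.exp (-bSeq J (j + 1))) := by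
    rw [cSeq, mul_assoc, ENNReal.ofReal_mul (cSeq_pos J j).le]
  rw [hC]
  simp only [bSeq]
  ring

/-- **THE RING RECURSION**: after merging the positions `1, …, j` (`j ≤ n`) the partial marginal of the ring integrand
is bounded by `C_j · (remaining ring factors) · e^{b_j ½Re tr(head_j W_0⁻¹)}`. [cite: TomboulisYaffe1985, §III (3.13)–(3.15), p. 324] -/
theorem lmarginal_mergedPos_le_mergeBound (hJ : 0 < J) {j : ℕ} (hj : j ≤ n) :
    ∫⋯∫⁻_(mergedPos n j), (fun W => ∏ t, ringFac J g g' W t)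
        ∂(fun _ : ZMod (n + 1) => QuantumFieldTheory.haarProbability (Matrix.specialUnitaryGroup (Fin 2) ℂ)) ≤
      mergeBound J g g' j := by
  induction j with
  | zero =>
      rw [mergedPos_zero, lmarginal_empty]
      exact fun W => le_of_eq (prod_ringFac_eq_mergeBound_zero J g g' W)
  | succ j ih =>
      rw [mergedPos_succ hj, lmarginal_union _ _ (measurable_prod_ringFac J g g')
        (Finset.disjoint_singleton_left.mpr (pos_succ_notMem_mergedPos hj))]
      intro W
      exact (lmarginal_mono (ih (by omega)) W).trans (lmarginal_singleton_mergeBound_le J g g' hJ hj W)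

/-- **THE TRANSFER KERNEL IS BOUNDED BY THE RENORMALISED PAIR KERNEL** (TY (3.15)): for `J > 0` and `L₀ = n + 1`,
`K_{L₀}(g, g') ≤ C_n(J) · ∫ dU e^{b_n(J) ½Re tr(g U g'⁻¹ U⁻¹)} = C_n(J) · pairKernel (b_n J) g g'`.
[cite: TomboulisYaffe1985, §III (3.13)–(3.15), p. 324] -/
theorem transferKernel_succ_le_pairKernel (hJ : 0 < J) :
    transferKernel (fundamentalRep (Fin 2)) (n + 1) J g g' ≤
      ENNReal.ofReal (cSeq J n * pairKernel (bSeq J n) g g') := by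
  classical
  set W₁ : ZMod (n + 1) → (Matrix.specialUnitaryGroup (Fin 2) ℂ) := fun _ => 1 with hW₁
  have h1 : transferKernel (fundamentalRep (Fin 2)) (n + 1) J g g' =
      (∫⋯∫⁻_({0} ∪ mergedPos n n), (fun W => ∏ t, ringFac J g g' W t)
        ∂(fun _ : ZMod (n + 1) => QuantumFieldTheory.haarProbability (Matrix.specialUnitaryGroup (Fin 2) ℂ))) W₁ := by
    rw [transferKernel, zero_union_mergedPos, ← lintegral_eq_lmarginal_univ W₁]
    simp_rw [prod_plaqFactor_eq_prod_ringFac]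
  rw [h1, lmarginal_union _ _ (measurable_prod_ringFac J g g')
    (Finset.disjoint_singleton_left.mpr (zero_notMem_mergedPos n))]
  refine (lmarginal_mono (lmarginal_mergedPos_le_mergeBound J g g' hJ le_rfl) W₁).trans ?_
  rw [lmarginal_singleton]
  have hint : ∀ V : (Matrix.specialUnitaryGroup (Fin 2) ℂ), mergeBound J g g' n (update W₁ 0 V) =
      ENNReal.ofReal (cSeq J n) * ENNReal.ofReal (Real.exp (bSeq J n * htr (g * V * g'⁻¹ * V⁻¹))) := by
    intro V
    rw [mergeBound, restPos_last, Finset.prod_empty, mul_one, ringHead_pos_last, update_self]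
  simp only [hint]
  have hmeas : Measurable fun V : (Matrix.specialUnitaryGroup (Fin 2) ℂ) =>
      ENNReal.ofReal (Real.exp (bSeq J n * htr (g * V * g'⁻¹ * V⁻¹))) := by
    have hc : Continuous (htr : (Matrix.specialUnitaryGroup (Fin 2) ℂ) → ℝ) :=
      (Complex.continuous_re.comp (continuous_subtype_val.matrix_trace)).div_const _
    exact (ENNReal.measurable_ofReal.comp (Real.continuous_exp.comp (continuous_const.mul
      (hc.comp (((continuous_const.mul continuous_id).mul continuous_const).mul continuous_inv)))).measurable)
  rw [lintegral_const_mul _ hmeas, ENNReal.ofReal_mul (cSeq_pos J n).le, pairKernel_eq_integral_exp_htr,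
    ofReal_integral_eq_lintegral_ofReal _ (Eventually.of_forall fun V => (Real.exp_pos _).le)]
  have hc : Continuous (htr : (Matrix.specialUnitaryGroup (Fin 2) ℂ) → ℝ) :=
    (Complex.continuous_re.comp (continuous_subtype_val.matrix_trace)).div_const _
  exact (Real.continuous_exp.comp (continuous_const.mul (hc.comp (((continuous_const.mul continuous_id).mul
    continuous_const).mul continuous_inv)))).integrable_of_hasCompactSupport (HasCompactSupport.of_compactSpace _)

/-- The same for any `L₀ ≥ 1`, with `n = L₀ − 1` merges. [cite: TomboulisYaffe1985, §III (3.13)–(3.15), p. 324] -/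
theorem transferKernel_le_pairKernel (L₀ : ℕ) [NeZero L₀] (hJ : 0 < J) :
    transferKernel (fundamentalRep (Fin 2)) L₀ J g g' ≤
      ENNReal.ofReal (cSeq J (L₀ - 1) * pairKernel (bSeq J (L₀ - 1)) g g') := by
  obtain ⟨n, hn⟩ := Nat.exists_eq_succ_of_ne_zero (NeZero.ne L₀)
  subst hn
  exact transferKernel_succ_le_pairKernel J g g' hJ

end Recursion

/-! ### §4. Class angles: subadditivity, and the cap lower bound on the transfer kernel -/

section Lower

variable {n : ℕ} (J : ℝ) (g g' : (Matrix.specialUnitaryGroup (Fin 2) ℂ))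

/-- `classAngle Q = arccos(½Re tr Q)`. [cite: TomboulisYaffe1985, §III (3.17), p. 324] -/
theorem classAngle_eq_arccos_htr (Q : (Matrix.specialUnitaryGroup (Fin 2) ℂ)) : classAngle Q = Real.arccos (htr Q) := rfl

/-- `classAngle 1 = 0`. [cite: TomboulisYaffe1985, §III (3.17), p. 324] -/
theorem classAngle_one : classAngle (1 : (Matrix.specialUnitaryGroup (Fin 2) ℂ)) = 0 := by
  rw [classAngle_eq_arccos_htr, htr]
  simp

/-- `½Re tr` is a class function. [folklore] -/
private theorem htr_conj (R X : (Matrix.specialUnitaryGroup (Fin 2) ℂ)) : htr (R * X * R⁻¹) = htr X := by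
  rw [htr, htr, Literature.Computability.QuantumComplexity.trace_conj]

/-- **Subadditivity of the class angle, twisted form**: `cos(θ_g + θ_{g'}) ≤ ½Re tr(g V g'⁻¹ V⁻¹)` for all `V`
(the adjoint-orbit formula `½Re tr(D(ω)UD(ω')⁻¹U⁻¹) = |U₀₀|² cos(ω−ω') + |U₀₁|² cos(ω+ω')`). [cite: TomboulisYaffe1985, §III (3.16)–(3.17), p. 324] -/
theorem cos_add_classAngle_le_htr (V : (Matrix.specialUnitaryGroup (Fin 2) ℂ)) :
    Real.cos (classAngle g + classAngle g') ≤ htr (g * V * g'⁻¹ * V⁻¹) := by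
  obtain ⟨R, ω, hω0, hωπ, hg⟩ := exists_conj_torus g
  obtain ⟨R', ω', hω0', hωπ', hg'⟩ := exists_conj_torus g'
  rw [hg, hg', classAngle_conj_torus R hω0 hωπ, classAngle_conj_torus R' hω0' hωπ']
  set U : (Matrix.specialUnitaryGroup (Fin 2) ℂ) := R⁻¹ * V * R' with hU
  have hconj : R * torus ω * R⁻¹ * V * (R' * torus ω' * R'⁻¹)⁻¹ * V⁻¹ =
      R * (torus ω * U * (torus ω')⁻¹ * U⁻¹) * R⁻¹ := by
    rw [hU]; group
  rw [hconj, htr_conj, htr, re_trace_torus_conj]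
  have h1 := MullerSchiemann1987.HeatKernel.normSq_add_normSq U
  have hu0 : 0 ≤ Complex.normSq ((U : Matrix (Fin 2) (Fin 2) ℂ) 0 0) := Complex.normSq_nonneg _
  have hu1 : 0 ≤ Complex.normSq ((U : Matrix (Fin 2) (Fin 2) ℂ) 0 1) := Complex.normSq_nonneg _
  have hcos : Real.cos (ω + ω') ≤ Real.cos (ω - ω') := by
    rw [Real.cos_add, Real.cos_sub]
    nlinarith [Real.sin_nonneg_of_nonneg_of_le_pi hω0 hωπ, Real.sin_nonneg_of_nonneg_of_le_pi hω0' hωπ']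
  have hu1' : Complex.normSq ((U : Matrix (Fin 2) (Fin 2) ℂ) 0 1) = 1 - Complex.normSq ((U : Matrix (Fin 2) (Fin 2) ℂ) 0 0) := by
    linarith
  rw [hu1']
  nlinarith [mul_nonneg hu0 (sub_nonneg.mpr hcos)]

/-- **Subadditivity of the class angle**: `cos(θ_P + θ_Q) ≤ ½Re tr(P Q⁻¹)`. [cite: TomboulisYaffe1985, §III (3.17), p. 324] -/
theorem cos_add_classAngle_le_htr_mul_inv (P Q : (Matrix.specialUnitaryGroup (Fin 2) ℂ)) :
    Real.cos (classAngle P + classAngle Q) ≤ htr (P * Q⁻¹) := by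
  simpa using cos_add_classAngle_le_htr P Q 1

/-- `θ(P Q⁻¹) ≤ θ_P + θ_Q` when the right-hand side is at most `π`. [cite: TomboulisYaffe1985, §III (3.17), p. 324] -/
theorem classAngle_mul_inv_le {P Q : (Matrix.specialUnitaryGroup (Fin 2) ℂ)} (h : classAngle P + classAngle Q ≤ Real.pi) :
    classAngle (P * Q⁻¹) ≤ classAngle P + classAngle Q := by
  rw [classAngle_eq_arccos_htr]
  calc Real.arccos (htr (P * Q⁻¹)) ≤ Real.arccos (Real.cos (classAngle P + classAngle Q)) :=
        Real.arccos_le_arccos (cos_add_classAngle_le_htr_mul_inv P Q)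
    _ = classAngle P + classAngle Q :=
        Real.arccos_cos (add_nonneg (classAngle_nonneg P) (classAngle_nonneg Q)) h

/-- A lower bound for one ring factor from the class angles: if `θ(A B⁻¹... )`: if `cos` of an angle bound `a ≤ π`
dominates, `e^{2J cos a} ≤ e^{2J ½Re tr(P Q⁻¹)}` whenever `θ_P + θ_Q ≤ a ≤ π`. [folklore] -/
private theorem exp_cos_le_exp_htr (hJ : 0 ≤ J) {P Q : (Matrix.specialUnitaryGroup (Fin 2) ℂ)} {a : ℝ}
    (ha : classAngle P + classAngle Q ≤ a) (haπ : a ≤ Real.pi) :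
    Real.exp (2 * J * Real.cos a) ≤ Real.exp (2 * J * htr (P * Q⁻¹)) := by
  refine Real.exp_le_exp.mpr (mul_le_mul_of_nonneg_left ?_ (by linarith))
  refine le_trans ?_ (cos_add_classAngle_le_htr_mul_inv P Q)
  exact Real.cos_le_cos_of_nonneg_of_le_pi (add_nonneg (classAngle_nonneg P) (classAngle_nonneg Q)) haπ ha

/-- The polar cap `{Q : θ_Q ≤ δ}` of `SU(2)`. [cite: TomboulisYaffe1985, §III (3.17), p. 324] -/
def polarCap (δ : ℝ) : Set (Matrix.specialUnitaryGroup (Fin 2) ℂ) := {Q | classAngle Q ≤ δ}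

/-- The polar cap is measurable (closed). [folklore] -/
private theorem measurableSet_polarCap (δ : ℝ) : MeasurableSet (polarCap δ) := by
  have hc : Continuous fun Q : (Matrix.specialUnitaryGroup (Fin 2) ℂ) => classAngle Q := by
    have h : Continuous (htr : (Matrix.specialUnitaryGroup (Fin 2) ℂ) → ℝ) :=
      (Complex.continuous_re.comp (continuous_subtype_val.matrix_trace)).div_const _
    exact Real.continuous_arccos.comp h
  exact measurableSet_le hc.measurable measurable_const

/-- **THE CAP LOWER BOUND ON THE TRANSFER KERNEL**: for twists in the cap `θ ≤ ε` and `0 ≤ δ`, `2δ ≤ π`,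
`2ε + δ ≤ π`,
`K_{n+1}(g, g') ≥ μ(cap_δ)^n · exp{2J [n cos 2δ + cos(2ε + δ)]}`
(restrict the `n` relative ring variables `W_t W_0⁻¹` to the cap and use subadditivity of the class angle).
[cite: TomboulisYaffe1985, §III (3.13)–(3.15), p. 324] -/
theorem le_transferKernel_of_classAngle_le (hJ : 0 ≤ J) {δ ε : ℝ} (hδ : 0 ≤ δ) (hδπ : 2 * δ ≤ Real.pi)
    (hεδ : 2 * ε + δ ≤ Real.pi) (hg : classAngle g ≤ ε) (hg' : classAngle g' ≤ ε) :
    (QuantumFieldTheory.haarProbability (Matrix.specialUnitaryGroup (Fin 2) ℂ)) (polarCap δ) ^ n *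
        ENNReal.ofReal (Real.exp (2 * J * (n * Real.cos (2 * δ) + Real.cos (2 * ε + δ)))) ≤
      transferKernel (fundamentalRep (Fin 2)) (n + 1) J g g' := by
  classical
  have hε : 0 ≤ ε := (classAngle_nonneg g).trans hg
  -- the restriction set and its indicator as a product
  set ind : ZMod (n + 1) → (ZMod (n + 1) → (Matrix.specialUnitaryGroup (Fin 2) ℂ)) → ℝ≥0∞ :=
    fun t W => (polarCap δ).indicator 1 (W t * (W 0)⁻¹) with hind
  have hindm : ∀ t, Measurable (ind t) := fun t =>
    (measurable_one.indicator (measurableSet_polarCap δ)).comp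
      ((measurable_pi_apply t).mul (measurable_pi_apply 0).inv)
  -- pointwise: indicator-product × constant ≤ ring integrand
  have hpt : ∀ W : ZMod (n + 1) → (Matrix.specialUnitaryGroup (Fin 2) ℂ),
      (∏ t ∈ mergedPos n n, ind t W) *
        ENNReal.ofReal (Real.exp (2 * J * (n * Real.cos (2 * δ) + Real.cos (2 * ε + δ)))) ≤
      ∏ t, ringFac J g g' W t := by
    intro W
    by_cases hW : ∀ t ∈ mergedPos n n, W t * (W 0)⁻¹ ∈ polarCap δ
    · have hind1 : ∏ t ∈ mergedPos n n, ind t W = 1 :=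
        Finset.prod_eq_one fun t ht => by simp [hind, Set.indicator_of_mem (hW t ht)]
      rw [hind1, one_mul]
      -- every relative variable has angle ≤ δ
      have hrel : ∀ t : ZMod (n + 1), classAngle (W t * (W 0)⁻¹) ≤ δ := by
        intro t
        by_cases ht : t = 0
        · rw [ht, mul_inv_cancel, classAngle_one]; exact hδ
        · have htm : t ∈ mergedPos n n := by
            rw [mem_mergedPos]
            have := ZMod.val_lt t
            refine ⟨Nat.one_le_iff_ne_zero.mpr fun h0 => ht ?_, by omega⟩
            rw [eq_pos_val t, h0, pos_zero]
          exact hW t htm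
      -- factor by factor
      have hfac : ∀ t : ZMod (n + 1), ENNReal.ofReal (Real.exp (2 * J *
          (if t + 1 = 0 then Real.cos (2 * ε + δ) else Real.cos (2 * δ)))) ≤ ringFac J g g' W t := by
        intro t
        rw [ringFac]
        refine ENNReal.ofReal_le_ofReal ?_
        have hWW : ringHead g g' W t * (W t)⁻¹ = ringHead g g' W t * (W 0)⁻¹ * (W t * (W 0)⁻¹)⁻¹ := by group
        rw [hWW]
        split_ifs with h0
        · -- the twisted factor
          have hH : ringHead g g' W t * (W 0)⁻¹ = g * W 0 * g'⁻¹ * (W 0)⁻¹ := by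
            rw [ringHead, if_pos h0, if_pos h0, h0]
          rw [hH]
          refine exp_cos_le_exp_htr J hJ ?_ hεδ
          have h2 : classAngle (g * W 0 * g'⁻¹ * (W 0)⁻¹) ≤ 2 * ε := by
            rw [classAngle_eq_arccos_htr]
            calc Real.arccos (htr (g * W 0 * g'⁻¹ * (W 0)⁻¹))
                ≤ Real.arccos (Real.cos (classAngle g + classAngle g')) :=
                  Real.arccos_le_arccos (cos_add_classAngle_le_htr g g' (W 0))
              _ = classAngle g + classAngle g' := Real.arccos_cos
                  (add_nonneg (classAngle_nonneg g) (classAngle_nonneg g')) (by linarith)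
              _ ≤ 2 * ε := by linarith
          linarith [hrel t]
        · -- an untwisted factor
          have hH : ringHead g g' W t = W (t + 1) := by
            rw [ringHead, if_neg h0, if_neg h0, inv_one, one_mul, mul_one]
          rw [hH]
          refine exp_cos_le_exp_htr J hJ ?_ hδπ
          linarith [hrel (t + 1), hrel t]
      -- multiply the factor bounds
      calc ENNReal.ofReal (Real.exp (2 * J * (n * Real.cos (2 * δ) + Real.cos (2 * ε + δ))))
          = ∏ t : ZMod (n + 1), ENNReal.ofReal (Real.exp (2 * J *
              (if t + 1 = 0 then Real.cos (2 * ε + δ) else Real.cos (2 * δ)))) := by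
            rw [← ENNReal.ofReal_prod_of_nonneg (fun t _ => (Real.exp_pos _).le), ← Real.exp_sum]
            congr 1
            rw [← Finset.mul_sum]
            congr 1
            have hiff : ∀ t : ZMod (n + 1), t + 1 = 0 ↔ t = pos n n := fun t =>
              ⟨fun h => add_right_cancel (h.trans pos_last_add_one.symm), fun h => h ▸ pos_last_add_one⟩
            rw [← Finset.add_sum_erase Finset.univ _ (Finset.mem_univ (pos n n)), if_pos pos_last_add_one,
              Finset.sum_congr rfl (fun t ht => if_neg (fun h => (Finset.ne_of_mem_erase ht) ((hiff t).mp h))),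
              Finset.sum_const, Finset.card_erase_of_mem (Finset.mem_univ _), Finset.card_univ, ZMod.card,
              Nat.add_sub_cancel, nsmul_eq_mul]
            ring
        _ ≤ ∏ t, ringFac J g g' W t := Finset.prod_le_prod' fun t _ => hfac t
    · push Not at hW
      obtain ⟨t, ht, hnot⟩ := hW
      have h0 : ∏ t ∈ mergedPos n n, ind t W = 0 :=
        Finset.prod_eq_zero ht (by simp [hind, Set.indicator_of_notMem hnot])
      rw [h0, zero_mul]
      exact bot_le
  -- integrate the pointwise bound
  have hK : transferKernel (fundamentalRep (Fin 2)) (n + 1) J g g' =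
      ∫⁻ W, ∏ t, ringFac J g g' W t ∂Measure.pi fun _ : ZMod (n + 1) =>
        QuantumFieldTheory.haarProbability (Matrix.specialUnitaryGroup (Fin 2) ℂ) := by
    rw [transferKernel]; simp_rw [prod_plaqFactor_eq_prod_ringFac]
  rw [hK]
  refine le_trans ?_ (lintegral_mono hpt)
  rw [lintegral_mul_const _ (Finset.measurable_prod _ fun t _ => hindm t)]
  refine mul_le_mul_left (le_of_eq ?_) _
  -- the mass of the restriction set: `μ(cap)^n`
  set W₁ : ZMod (n + 1) → (Matrix.specialUnitaryGroup (Fin 2) ℂ) := fun _ => 1 with hW₁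
  have hone : ∀ (t : ZMod (n + 1)), t ∈ mergedPos n n → ∀ W : ZMod (n + 1) → (Matrix.specialUnitaryGroup (Fin 2) ℂ),
      (∫⋯∫⁻_{t}, ind t ∂fun _ : ZMod (n + 1) => QuantumFieldTheory.haarProbability
        (Matrix.specialUnitaryGroup (Fin 2) ℂ)) W =
      (QuantumFieldTheory.haarProbability (Matrix.specialUnitaryGroup (Fin 2) ℂ)) (polarCap δ) := by
    intro t ht W
    have ht0 : t ≠ 0 := by
      intro h; rw [h] at ht; exact zero_notMem_mergedPos n ht
    rw [lmarginal_singleton]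
    simp only [hind, update_self, update_of_ne ht0.symm]
    rw [lintegral_mul_right_eq_self (fun U : (Matrix.specialUnitaryGroup (Fin 2) ℂ) => (polarCap δ).indicator 1 U)
      (W 0)⁻¹, lintegral_indicator_one (measurableSet_polarCap δ)]
  have hinner : ∫⋯∫⁻_(mergedPos n n), (fun W => ∏ t ∈ mergedPos n n, ind t W)
      ∂(fun _ : ZMod (n + 1) => QuantumFieldTheory.haarProbability (Matrix.specialUnitaryGroup (Fin 2) ℂ)) =
      fun _ => (QuantumFieldTheory.haarProbability (Matrix.specialUnitaryGroup (Fin 2) ℂ)) (polarCap δ) ^ n := by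
    have h := lmarginal_biUnion_prod_eq_prod
      (μ := fun _ : ZMod (n + 1) => QuantumFieldTheory.haarProbability (Matrix.specialUnitaryGroup (Fin 2) ℂ))
      (mergedPos n n) (fun t => ({t} : Finset (ZMod (n + 1))))
      (fun t => ({i | i = t ∨ i = 0} : Set (ZMod (n + 1)))) ind hindm
      (fun t => by
        intro U V hUV
        simp only [hind, hUV t (Or.inl rfl), hUV 0 (Or.inr rfl)])
      (fun b hb b' hb' hbb' i hi => by
        rw [Finset.mem_singleton] at hi
        subst hi
        rintro (h | h)
        · exact hbb' h.symm
        · rw [h] at hb'; exact zero_notMem_mergedPos n hb')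
      (fun b _ b' _ hbb' => Finset.disjoint_singleton.mpr hbb')
    rw [Finset.biUnion_singleton_eq_self] at h
    rw [h]
    funext W
    rw [Finset.prod_congr rfl (fun t ht => hone t ht W), Finset.prod_const]
    congr 1
    -- `card (mergedPos n n) = n`
    have hm : mergedPos n n = Finset.univ.erase 0 := by
      ext t
      simp only [mem_mergedPos, Finset.mem_erase, Finset.mem_univ, and_true]
      constructor
      · rintro ⟨h1, -⟩ h; rw [h, ZMod.val_zero] at h1; omega
      · intro h
        have := ZMod.val_lt t
        refine ⟨Nat.one_le_iff_ne_zero.mpr fun h0 => h ?_, by omega⟩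
        rw [eq_pos_val t, h0, pos_zero]
    rw [hm, Finset.card_erase_of_mem (Finset.mem_univ _), Finset.card_univ, ZMod.card, Nat.add_sub_cancel]
  calc (QuantumFieldTheory.haarProbability (Matrix.specialUnitaryGroup (Fin 2) ℂ)) (polarCap δ) ^ n
      = (∫⋯∫⁻_({0} ∪ mergedPos n n), (fun W => ∏ t ∈ mergedPos n n, ind t W)
          ∂(fun _ : ZMod (n + 1) => QuantumFieldTheory.haarProbability (Matrix.specialUnitaryGroup (Fin 2) ℂ))) W₁ := by
        rw [lmarginal_union _ _ (Finset.measurable_prod _ fun t _ => hindm t)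
          (Finset.disjoint_singleton_left.mpr (zero_notMem_mergedPos n)), hinner, lmarginal_singleton]
        simp
    _ = ∫⁻ W, ∏ t ∈ mergedPos n n, ind t W ∂Measure.pi fun _ : ZMod (n + 1) =>
          QuantumFieldTheory.haarProbability (Matrix.specialUnitaryGroup (Fin 2) ℂ) := by
        rw [zero_union_mergedPos, ← lintegral_eq_lmarginal_univ W₁]

/-- The same for any `L₀ ≥ 1` (`n = L₀ − 1` relative ring variables). [cite: TomboulisYaffe1985, §III (3.13)–(3.15), p. 324] -/
theorem le_transferKernel_of_classAngle_le' (L₀ : ℕ) [NeZero L₀] (hJ : 0 ≤ J) {δ ε : ℝ} (hδ : 0 ≤ δ)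
    (hδπ : 2 * δ ≤ Real.pi) (hεδ : 2 * ε + δ ≤ Real.pi) (hg : classAngle g ≤ ε) (hg' : classAngle g' ≤ ε) :
    (QuantumFieldTheory.haarProbability (Matrix.specialUnitaryGroup (Fin 2) ℂ)) (polarCap δ) ^ (L₀ - 1) *
        ENNReal.ofReal (Real.exp (2 * J * ((L₀ - 1 : ℕ) * Real.cos (2 * δ) + Real.cos (2 * ε + δ)))) ≤
      transferKernel (fundamentalRep (Fin 2)) L₀ J g g' := by
  obtain ⟨n, hn⟩ := Nat.exists_eq_succ_of_ne_zero (NeZero.ne L₀)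
  subst hn
  simpa using le_transferKernel_of_classAngle_le J g g' hJ hδ hδπ hεδ hg hg'

end Lower

/-! ### §5. Sizes: `2J/4^j ≤ b_j ≤ 2J`, `C_j e^{b_j} ≤ e^{2J}(c₂ e^{2J}/J^{3/2})^j`, and the two-sided kernel
bound at coincidence (the lower cap bound is `≥ κ_n · C_n e^{b_n}`) -/

section Sizes

variable {n : ℕ} (J : ℝ) (g g' : (Matrix.specialUnitaryGroup (Fin 2) ℂ))

/-- `Φ(z) ≤ e^{z}` for `z ≥ 0`, hence `ln Φ(z) ≤ z`. [cite: TomboulisYaffe1985, §III (3.14), p. 324] -/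
theorem log_classExp_le {z : ℝ} (hz : 0 ≤ z) : Real.log (classExp z) ≤ z := by
  have h1 : classExp z ≤ Real.exp z := by
    have hc : ∫ _V, Real.exp z ∂(QuantumFieldTheory.haarProbability (Matrix.specialUnitaryGroup (Fin 2) ℂ)) =
        Real.exp z := by simp
    rw [classExp, ← hc]
    refine integral_mono_of_nonneg (Eventually.of_forall fun V => (Real.exp_pos _).le) (integrable_const _)
      (Eventually.of_forall fun V => Real.exp_le_exp.mpr ?_)
    have := (htr_mem_Icc V).2
    nlinarith
  calc Real.log (classExp z) ≤ Real.log (Real.exp z) := Real.log_le_log (classExp_pos z) h1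
    _ = z := Real.log_exp z

/-- **`b_j ≤ 2J`** (`J > 0`). [cite: TomboulisYaffe1985, §III (3.14), p. 324] -/
theorem bSeq_le (hJ : 0 < J) : ∀ j, bSeq J j ≤ 2 * J
  | 0 => by simp [bSeq]
  | j + 1 => by
      have hb := bSeq_nonneg hJ.le j
      have hs : 0 < 2 * J + bSeq J j := by linarith
      have hlog := log_classExp_le (z := 2 * J + bSeq J j) hs.le
      have hlog0 : 0 ≤ Real.log (classExp (2 * J + bSeq J j)) := Real.log_nonneg (one_le_classExp _)
      simp only [bSeq]
      rw [div_le_iff₀ (pow_pos hs 2)]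
      calc 2 * J * bSeq J j * Real.log (classExp (2 * J + bSeq J j))
          ≤ 2 * J * bSeq J j * (2 * J + bSeq J j) :=
            mul_le_mul_of_nonneg_left hlog (mul_nonneg (by linarith) hb)
        _ ≤ 2 * J * (2 * J + bSeq J j) ^ 2 := by
            have h4 : 0 ≤ 2 * J * (2 * J + bSeq J j) * (2 * J) := by positivity
            nlinarith [h4]

/-- The one-link lower bound in logarithmic form: `ln Φ(z) ≥ z/2` for `z ≥ 32`. [cite: TomboulisYaffe1985, §III (3.14), p. 324] -/
theorem half_le_log_classExp {z : ℝ} (hz : 32 ≤ z) : z / 2 ≤ Real.log (classExp z) := by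
  set x := z / 2 with hx
  have hx16 : 16 ≤ x := by rw [hx]; linarith
  have hx0 : 0 < x := by linarith
  have hlow := exp_div_le_classExp (z := z) (by linarith)
  rw [← hx] at hlow
  -- numerics: `8/(3eπ³) ≥ 3/128` and `e^x ≥ x⁴/24`, `√x ≤ x/4`
  have hπ3 : Real.pi ^ 3 < 32 := by
    have h := pow_lt_pow_left₀ Real.pi_lt_d2 Real.pi_pos.le (by norm_num : (3 : ℕ) ≠ 0)
    exact h.trans (by norm_num)
  have he : Real.exp 1 < 2.72 := lt_trans Real.exp_one_lt_d9 (by norm_num)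
  have hc : 3 / 128 ≤ 8 / (3 * Real.exp 1 * Real.pi ^ 3) := by
    rw [div_le_div_iff₀ (by norm_num) (by positivity)]
    nlinarith [Real.exp_pos 1, pow_pos Real.pi_pos 3]
  have hsqrt : Real.sqrt x ≤ x / 4 := by
    rw [Real.sqrt_le_left (by linarith)]
    nlinarith
  have hexp4 : x ^ 4 / 24 ≤ Real.exp x := by
    have := Real.pow_div_factorial_le_exp x hx0.le 4
    simpa [Nat.factorial] using this
  -- `e^{x} ≤ Φ(z)`: from `Φ(z) ≥ c e^{2x}/(x√x)` and `c e^{x} ≥ x√x`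
  have hkey : Real.exp x ≤ classExp z := by
    refine le_trans ?_ hlow
    rw [show Real.exp z = Real.exp x * Real.exp x by rw [← Real.exp_add]; congr 1; linarith]
    have hxs : 0 < x * Real.sqrt x := mul_pos hx0 (Real.sqrt_pos.mpr hx0)
    have h2 : x * Real.sqrt x ≤ 3 / 128 * Real.exp x := by
      have h16 : 0 ≤ x ^ 2 * (x - 16) * (x + 16) :=
        mul_nonneg (mul_nonneg (sq_nonneg x) (by linarith)) (by linarith)
      calc x * Real.sqrt x ≤ x * (x / 4) := mul_le_mul_of_nonneg_left hsqrt hx0.le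
        _ ≤ 3 / 128 * (x ^ 4 / 24) := by nlinarith [h16]
        _ ≤ 3 / 128 * Real.exp x := by linarith
    have h3 : x * Real.sqrt x ≤ 8 / (3 * Real.exp 1 * Real.pi ^ 3) * Real.exp x :=
      h2.trans (mul_le_mul_of_nonneg_right hc (Real.exp_pos x).le)
    rw [← mul_div_assoc, le_div_iff₀ hxs]
    calc Real.exp x * (x * Real.sqrt x) ≤ Real.exp x * (8 / (3 * Real.exp 1 * Real.pi ^ 3) * Real.exp x) :=
          mul_le_mul_of_nonneg_left h3 (Real.exp_pos x).le
      _ = 8 / (3 * Real.exp 1 * Real.pi ^ 3) * (Real.exp x * Real.exp x) := by ring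
  calc z / 2 = x := hx.symm
    _ = Real.log (Real.exp x) := (Real.log_exp x).symm
    _ ≤ Real.log (classExp z) := Real.log_le_log (Real.exp_pos x) hkey

/-- **`b_j ≥ 2J/4^j`** for `J ≥ 16` (the renormalised coupling stays of order `J`: TY's "`β_> ∼ β_t/L_t`").
[cite: TomboulisYaffe1985, §III (3.14), p. 324] -/
theorem bSeq_ge (hJ : 16 ≤ J) : ∀ j, 2 * J / 4 ^ j ≤ bSeq J j
  | 0 => by simp [bSeq]
  | j + 1 => by
      have hJ0 : 0 < J := by linarith
      have hb := bSeq_nonneg hJ0.le j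
      have hble := bSeq_le J hJ0 j
      have ih := bSeq_ge hJ j
      have hs : 0 < 2 * J + bSeq J j := by linarith
      have hlog : (2 * J + bSeq J j) / 2 ≤ Real.log (classExp (2 * J + bSeq J j)) :=
        half_le_log_classExp (by linarith)
      simp only [bSeq]
      -- `b_{j+1} ≥ 2J b (2J+b)/2/(2J+b)² = J b/(2J+b) ≥ b/4`
      have h1 : bSeq J j / 4 ≤ 2 * J * bSeq J j * Real.log (classExp (2 * J + bSeq J j)) / (2 * J + bSeq J j) ^ 2 := by
        rw [div_le_div_iff₀ (by norm_num) (pow_pos hs 2)]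
        calc bSeq J j * (2 * J + bSeq J j) ^ 2 ≤ (2 * J * bSeq J j * ((2 * J + bSeq J j) / 2)) * 4 := by
              nlinarith [mul_nonneg hb hb, mul_nonneg hJ0.le hb]
          _ ≤ 2 * J * bSeq J j * Real.log (classExp (2 * J + bSeq J j)) * 4 := by
              have := mul_le_mul_of_nonneg_left hlog (mul_nonneg (by linarith : (0:ℝ) ≤ 2 * J) hb)
              nlinarith [this]
      refine le_trans ?_ h1
      rw [pow_succ, ← div_div]
      linarith [div_le_div_of_nonneg_right ih (by norm_num : (0:ℝ) ≤ 4)]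

/-- **The prefactor at coincidence**: `C_j e^{b_j} ≤ e^{2J} · (c₂ e^{2J}/(J√J))^j` with `c₂ = π²√π/16`
(each merge costs one one-link partition function `Φ(2J + b) ≍ e^{2J+b}(J + b/2)^{−3/2}`).
[cite: TomboulisYaffe1985, §III (3.15), p. 324] -/
theorem cSeq_mul_exp_bSeq_le (hJ : 0 < J) : ∀ j, cSeq J j * Real.exp (bSeq J j) ≤
    Real.exp (2 * J) * (Real.pi ^ 2 * Real.sqrt Real.pi / 16 * Real.exp (2 * J) / (J * Real.sqrt J)) ^ j
  | 0 => by simp [cSeq, bSeq]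
  | j + 1 => by
      have ih := cSeq_mul_exp_bSeq_le hJ j
      have hb := bSeq_nonneg hJ.le j
      have hC := (cSeq_pos J j).le
      have hs : 0 < 2 * J + bSeq J j := by linarith
      -- `Φ(2J+b) ≤ c₂ e^{2J+b}/((J+b/2)√(J+b/2)) ≤ c₂ e^{2J} e^{b}/(J√J)`
      have hΦ := classExp_le (z := 2 * J + bSeq J j) hs
      have hden : J * Real.sqrt J ≤ (2 * J + bSeq J j) / 2 * Real.sqrt ((2 * J + bSeq J j) / 2) := by
        have h1 : J ≤ (2 * J + bSeq J j) / 2 := by linarith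
        exact mul_le_mul h1 (Real.sqrt_le_sqrt h1) (Real.sqrt_nonneg _) (by linarith)
      have hJs : 0 < J * Real.sqrt J := mul_pos hJ (Real.sqrt_pos.mpr hJ)
      have hΦ' : classExp (2 * J + bSeq J j) ≤
          Real.pi ^ 2 * Real.sqrt Real.pi / 16 * Real.exp (2 * J) / (J * Real.sqrt J) * Real.exp (bSeq J j) := by
        calc classExp (2 * J + bSeq J j)
            ≤ Real.pi ^ 2 * Real.sqrt Real.pi / 16 * (Real.exp (2 * J + bSeq J j) /
                ((2 * J + bSeq J j) / 2 * Real.sqrt ((2 * J + bSeq J j) / 2))) := hΦ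
          _ ≤ Real.pi ^ 2 * Real.sqrt Real.pi / 16 * (Real.exp (2 * J + bSeq J j) / (J * Real.sqrt J)) :=
              mul_le_mul_of_nonneg_left (div_le_div_of_nonneg_left (Real.exp_pos _).le hJs hden) (by positivity)
          _ = Real.pi ^ 2 * Real.sqrt Real.pi / 16 * Real.exp (2 * J) / (J * Real.sqrt J) * Real.exp (bSeq J j) := by
              rw [Real.exp_add]; ring
      calc cSeq J (j + 1) * Real.exp (bSeq J (j + 1))
          = cSeq J j * classExp (2 * J + bSeq J j) := by
            simp only [cSeq]; rw [mul_assoc (cSeq J j * classExp _), ← Real.exp_add]; simp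
        _ ≤ cSeq J j * (Real.pi ^ 2 * Real.sqrt Real.pi / 16 * Real.exp (2 * J) / (J * Real.sqrt J) *
              Real.exp (bSeq J j)) := mul_le_mul_of_nonneg_left hΦ' hC
        _ = cSeq J j * Real.exp (bSeq J j) * (Real.pi ^ 2 * Real.sqrt Real.pi / 16 * Real.exp (2 * J) /
              (J * Real.sqrt J)) := by ring
        _ ≤ Real.exp (2 * J) * (Real.pi ^ 2 * Real.sqrt Real.pi / 16 * Real.exp (2 * J) / (J * Real.sqrt J)) ^ j *
              (Real.pi ^ 2 * Real.sqrt Real.pi / 16 * Real.exp (2 * J) / (J * Real.sqrt J)) :=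
            mul_le_mul_of_nonneg_right ih (by positivity)
        _ = Real.exp (2 * J) * (Real.pi ^ 2 * Real.sqrt Real.pi / 16 * Real.exp (2 * J) / (J * Real.sqrt J)) ^ (j + 1) := by
            rw [pow_succ]; ring

/-- The polar cap as a trace window: `{θ ≤ δ} = {2cos δ ≤ Re tr}` (`0 ≤ δ ≤ π`). [cite: TomboulisYaffe1985, §III (3.17), p. 324] -/
theorem polarCap_eq {δ : ℝ} (hδ : 0 ≤ δ) (hδπ : δ ≤ Real.pi) :
    polarCap δ = {W : (Matrix.specialUnitaryGroup (Fin 2) ℂ) | 2 * Real.cos δ ≤ ((W : Matrix (Fin 2) (Fin 2) ℂ).trace).re} := by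
  ext W
  simp only [polarCap, Set.mem_setOf_eq, classAngle_eq_arccos_htr]
  have hW := htr_mem_Icc W
  constructor
  · intro h
    have h1 : Real.cos δ ≤ Real.cos (Real.arccos (htr W)) :=
      Real.cos_le_cos_of_nonneg_of_le_pi (Real.arccos_nonneg _) hδπ h
    rw [Real.cos_arccos hW.1 hW.2] at h1
    unfold htr at h1
    linarith
  · intro h
    have h1 : Real.cos δ ≤ htr W := by unfold htr; linarith
    calc Real.arccos (htr W) ≤ Real.arccos (Real.cos δ) := Real.arccos_le_arccos h1
      _ = δ := Real.arccos_cos hδ hδπ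

/-- The cubic small-ball law for the cap: `μ(cap_δ) ≥ (8/3π³) δ³` for `0 ≤ δ ≤ π/2`. [cite: MontvayMunster1994, §3.2.3 (3.97) p.121] -/
theorem cube_le_measureReal_polarCap {δ : ℝ} (hδ : 0 ≤ δ) (hδπ : δ ≤ Real.pi / 2) :
    8 / (3 * Real.pi ^ 3) * δ ^ 3 ≤
      (QuantumFieldTheory.haarProbability (Matrix.specialUnitaryGroup (Fin 2) ℂ)).real (polarCap δ) := by
  rw [polarCap_eq hδ (hδπ.trans (by linarith [Real.pi_pos]))]
  exact SU2OneLink.cube_le_haarProbability_real_two_cos_le_re_trace hδ hδπ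

/-- The constant of the two-sided kernel bound at coincidence (depends on `n = L₀ − 1` only). [folklore] -/
def kernelRatioConst (n : ℕ) : ℝ :=
  ((8 / (3 * Real.pi ^ 3)) / (Real.pi ^ 2 * Real.sqrt Real.pi / 16)) ^ n * Real.exp (-(4 * n + 9))

/-- `kernelRatioConst n > 0`. [cite: TomboulisYaffe1985, §III (3.15), p. 324] -/
theorem kernelRatioConst_pos (n : ℕ) : 0 < kernelRatioConst n := by
  unfold kernelRatioConst; positivity

/-- **TWO-SIDED KERNEL BOUND AT COINCIDENCE**: for `J ≥ 1` and twists within `J^{-1/2}` of the identity, the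
transfer kernel is at least `κ_n · C_n(J) e^{b_n(J)}` — the scale of the UPPER bound `C_n · pairKernel(b_n)` at
`g = g' = 1` — so the upper bound (3.15) is sharp up to the constant `κ_n` (in `J`: both are
`≍ e^{2J(n+1)} J^{−3n/2}`). [cite: TomboulisYaffe1985, §III (3.13)–(3.15), p. 324] -/
theorem kernelScale_le_transferKernel (hJ : 1 ≤ J) (hg : classAngle g ≤ (Real.sqrt J)⁻¹)
    (hg' : classAngle g' ≤ (Real.sqrt J)⁻¹) :
    ENNReal.ofReal (kernelRatioConst n * (cSeq J n * Real.exp (bSeq J n))) ≤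
      transferKernel (fundamentalRep (Fin 2)) (n + 1) J g g' := by
  have hJ0 : 0 < J := by linarith
  set δ : ℝ := (Real.sqrt J)⁻¹ with hδ
  have hsJ : 1 ≤ Real.sqrt J := by rw [← Real.sqrt_one]; exact Real.sqrt_le_sqrt hJ
  have hsJ0 : 0 < Real.sqrt J := by linarith
  have hδ0 : 0 < δ := inv_pos.mpr hsJ0
  have hδ1 : δ ≤ 1 := inv_le_one_of_one_le₀ hsJ
  have hπ := Real.pi_gt_three
  have hδ2 : δ ^ 2 = J⁻¹ := by rw [hδ, inv_pow, Real.sq_sqrt hJ0.le]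
  have hδ3 : δ ^ 3 = (J * Real.sqrt J)⁻¹ := by
    rw [pow_succ, hδ2, hδ, ← mul_inv]
  have hJδ : J * δ ^ 2 = 1 := by rw [hδ2, mul_inv_cancel₀ hJ0.ne']
  -- the cap lower bound with `δ = ε = J^{-1/2}`
  have hlow := le_transferKernel_of_classAngle_le (n := n) J g g' hJ0.le hδ0.le (by linarith) (by linarith) hg hg'
  refine le_trans ?_ hlow
  rw [← ofReal_measureReal, ← ENNReal.ofReal_pow measureReal_nonneg,
    ← ENNReal.ofReal_mul (pow_nonneg measureReal_nonneg _)]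
  refine ENNReal.ofReal_le_ofReal ?_
  -- real-variable comparison
  have hcap : 8 / (3 * Real.pi ^ 3) * δ ^ 3 ≤
      (QuantumFieldTheory.haarProbability (Matrix.specialUnitaryGroup (Fin 2) ℂ)).real (polarCap δ) :=
    cube_le_measureReal_polarCap hδ0.le (by linarith)
  have hD := cSeq_mul_exp_bSeq_le J hJ0 n
  have hexp : 2 * J * (n + 1) - (4 * n + 9) ≤ 2 * J * (n * Real.cos (2 * δ) + Real.cos (2 * δ + δ)) := by
    have h1 := Real.one_sub_sq_div_two_le_cos (x := 2 * δ)
    have h2 := Real.one_sub_sq_div_two_le_cos (x := 2 * δ + δ)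
    have hn : (0 : ℝ) ≤ n := Nat.cast_nonneg n
    nlinarith [mul_nonneg hn hJ0.le, hJδ]
  calc kernelRatioConst n * (cSeq J n * Real.exp (bSeq J n))
      ≤ kernelRatioConst n * (Real.exp (2 * J) *
          (Real.pi ^ 2 * Real.sqrt Real.pi / 16 * Real.exp (2 * J) / (J * Real.sqrt J)) ^ n) :=
        mul_le_mul_of_nonneg_left hD (kernelRatioConst_pos n).le
    _ = (8 / (3 * Real.pi ^ 3) * δ ^ 3) ^ n * Real.exp (2 * J * (n + 1) - (4 * n + 9)) := by
        have hE : Real.exp (2 * J * (n + 1) - (4 * n + 9)) =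
            Real.exp (2 * J) * Real.exp (2 * J) ^ n * Real.exp (-(4 * n + 9)) := by
          rw [← Real.exp_nat_mul, ← Real.exp_add, ← Real.exp_add]; congr 1; ring
        rw [kernelRatioConst, hδ3, hE]
        simp only [div_pow, mul_pow, inv_pow]
        field_simp
    _ ≤ ((QuantumFieldTheory.haarProbability (Matrix.specialUnitaryGroup (Fin 2) ℂ)).real (polarCap δ)) ^ n *
          Real.exp (2 * J * (↑n * Real.cos (2 * δ) + Real.cos (2 * δ + δ))) :=
        mul_le_mul (pow_le_pow_left₀ (by positivity) hcap n) (Real.exp_le_exp.mpr hexp) (Real.exp_pos _).le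
          (pow_nonneg measureReal_nonneg n)

end Sizes

end

end Literature.MathematicalPhysics.QuantumFieldTheory.TomboulisYaffeHighTemperature
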